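import Mathlib
import Summits.Ventures.HodgeRepro.Tier4.Line1.RTFSetting
import Summits.Ventures.HodgeRepro.Tier4.Line1.RtfGeometric
import Summits.Ventures.HodgeRepro.Tier4.Line1.OrbitalTools

/-!
# Tier4/Line1/JContinuity — the RTF distribution `J` is continuous in the sup norm on test functions with supports in
a fixed compact set; a test function with `J(f) ≠ 0` keeps `J ≠ 0` under small uniform perturbations with the same
support bound

Blind re-derivation cell `pub-hodge-repro`, Tier 4 (README §9–§10), seat t4-L1-p4 (gen 4); CENSUS v14 §D names
«continuity of the orbital integral in `f₁` (in the tree's vocabulary … routine)» as one of the two ingredients of the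
archimedean half of the F2′ → (S1b) bridge (with a density statement for `K_∞`-finite functions, NOT here).  Target tree
path `lean/Summits/Ventures/HodgeRepro/Tier4/Line1/JContinuity.lean`.  Generic over every `RTF.Setting G`; Mathlib +
p2's `rtf_geometric` (RtfGeometric: `J(f) = ∑ᶠ o, O_o(f)`), `finite_hit_closure` / `eq_zero_of_notMem_hit` /
`norm_orbital_sub_le` (OrbitalTools) and the glue `orbital_eq_zero_of_not_mem` (RTFSetting); no printed input.

WHAT IS PROVED.  For a compact `M ⊆ G` let `Γ_M` be the finite set of rational `γ` with `t⁻¹ γ t′ ∈ M` for some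
`(t, t′) ∈ closure DT × closure DT′` (p2) and `O_M` its image in the double cosets.  For test functions supported in `M`:
`geoSupport f ⊆ O_M` (`geoSupport_subset_image_of_tsupport_subset`), `J(f) = ∑_{o ∈ O_M} O_o(f)`
(`J_eq_sum_orbital_of_tsupport_subset`), and the LIPSCHITZ ESTIMATE `‖J(f) − J(f′)‖ ≤ #O_M · #Γ_M · ‖f − f′‖_∞ ·
μ_T(DT) · μ_{T′}(DT′)` (`norm_J_sub_le`: p2's per-orbit estimate summed over `O_M`).  Hence
**`exists_nhds_J_ne_zero`**: if `J(f) ≠ 0` there is `η > 0` such that every test function `f′` supported in `M` with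
`‖f′ − f‖_∞ ≤ η` has `J(f′) ≠ 0` — what any approximation of the isolating pair by functions of a prescribed shape (at a
level, of a `K_∞`-type) needs from the analytic side: exact isolation `geoSupport = {o₀}` is NOT stable under
approximation (the approximant meets the other orbits of `O_M`), but `J ≠ 0` is.
Nothing here says anything about the status of the Hodge conjecture for CM abelian varieties, which is NOT proved
(HC_CM is NOT proved by anyone in this repository).
-/

set_option autoImplicit false

noncomputable section

namespace Summit.Ventures.HodgeRepro.Tier4.Line1.RTF

open MeasureTheory Topology

variable {G : Type} [Group G] [TopologicalSpace G] [IsTopologicalGroup G] [MeasurableSpace G] [BorelSpace G]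

namespace Setting

variable (S : Setting G)

open Classical in
omit [BorelSpace G] in
/-- the geometric support of a test function supported in the compact `M` lies in the orbits of the finitely many
rational points hit by `M` on `closure DT × closure DT′` -/
theorem geoSupport_subset_image_of_tsupport_subset {M : Set G} (hM : IsCompact M) {f : G → ℂ}
    (hfM : tsupport f ⊆ M) :
    S.geoSupport f ⊆ ((S.finite_hit_closure hM).toFinset.image S.orbitOf : Set S.Orbit) := by
  rintro o ⟨t, ht, t', ht', γ, rfl, hne⟩
  rw [Finset.coe_image, Set.Finite.coe_toFinset]
  refine ⟨γ, ⟨t, subset_closure ht, t', subset_closure ht', ?_⟩, rfl⟩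
  exact hfM (subset_tsupport _ (Function.mem_support.mpr hne))

open Classical in
/-- `J(f) = ∑_{o ∈ O_M} O_o(f)` for a test function supported in the compact `M` -/
theorem J_eq_sum_orbital_of_tsupport_subset {χ : S.T → ℂ} {χ' : S.T' → ℂ} (hχ : S.IsCharacter χ)
    (hχ' : S.IsCharacter' χ') {M : Set G} (hM : IsCompact M) {f : G → ℂ} (hf : IsTest f) (hfM : tsupport f ⊆ M) :
    S.J χ χ' f = ∑ o ∈ (S.finite_hit_closure hM).toFinset.image S.orbitOf, S.orbital χ χ' o f := by
  rw [S.rtf_geometric hχ hχ' hf]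
  apply finsum_eq_sum_of_support_subset
  intro o ho
  rw [Function.mem_support] at ho
  by_contra hoM
  exact ho (S.orbital_eq_zero_of_not_mem χ χ' fun hmem =>
    hoM (S.geoSupport_subset_image_of_tsupport_subset hM hfM hmem))

open Classical in
/-- **THE LIPSCHITZ ESTIMATE FOR `J`**: for two test functions supported in the compact `M` with `‖f − f′‖_∞ ≤ η`,
`‖J(f) − J(f′)‖ ≤ #O_M · #Γ_M · η · μ_T(DT) · μ_{T′}(DT′)`. -/
theorem norm_J_sub_le {χ : S.T → ℂ} {χ' : S.T' → ℂ} (hχ : S.IsCharacter χ) (hχ' : S.IsCharacter' χ')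
    {M : Set G} (hM : IsCompact M) {f f' : G → ℂ} (hf : IsTest f) (hf' : IsTest f') (hfM : tsupport f ⊆ M)
    (hf'M : tsupport f' ⊆ M) {η : ℝ} (hη : ∀ g, ‖f g - f' g‖ ≤ η) :
    ‖S.J χ χ' f - S.J χ χ' f'‖ ≤ (((S.finite_hit_closure hM).toFinset.image S.orbitOf).card : ℝ) *
      (((S.finite_hit_closure hM).toFinset.card : ℝ) * η * S.μT.real S.DT * S.μT'.real S.DT') := by
  rw [S.J_eq_sum_orbital_of_tsupport_subset hχ hχ' hM hf hfM,
    S.J_eq_sum_orbital_of_tsupport_subset hχ hχ' hM hf' hf'M, ← Finset.sum_sub_distrib]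
  refine (norm_sum_le _ _).trans ?_
  rw [← nsmul_eq_mul, ← Finset.sum_const]
  refine Finset.sum_le_sum fun o _ => ?_
  exact S.norm_orbital_sub_le hχ hχ' o hf hf' (fun γ hγ t ht t' ht' => S.eq_zero_of_notMem_hit hM hfM hγ ht ht')
    (fun γ hγ t ht t' ht' => S.eq_zero_of_notMem_hit hM hf'M hγ ht ht') hη

open Classical in
/-- **`J ≠ 0` is stable under small uniform perturbations with a common compact support bound**: if `J(f) ≠ 0` there is
`η > 0` such that every test function `f′` supported in `M` with `‖f′ − f‖_∞ ≤ η` has `J(f′) ≠ 0`. -/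
theorem exists_nhds_J_ne_zero {χ : S.T → ℂ} {χ' : S.T' → ℂ} (hχ : S.IsCharacter χ) (hχ' : S.IsCharacter' χ')
    {M : Set G} (hM : IsCompact M) {f : G → ℂ} (hf : IsTest f) (hfM : tsupport f ⊆ M) (hJ : S.J χ χ' f ≠ 0) :
    ∃ η : ℝ, 0 < η ∧ ∀ f' : G → ℂ, IsTest f' → tsupport f' ⊆ M → (∀ g, ‖f' g - f g‖ ≤ η) →
      S.J χ χ' f' ≠ 0 := by
  set C : ℝ := (((S.finite_hit_closure hM).toFinset.image S.orbitOf).card : ℝ) *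
    (((S.finite_hit_closure hM).toFinset.card : ℝ) * S.μT.real S.DT * S.μT'.real S.DT') with hC
  have hC0 : 0 ≤ C := by positivity
  have hJ0 : 0 < ‖S.J χ χ' f‖ := norm_pos_iff.2 hJ
  refine ⟨‖S.J χ χ' f‖ / (2 * (C + 1)), by positivity, fun f' hf' hf'M hη hJ' => ?_⟩
  have hle := S.norm_J_sub_le hχ hχ' hM hf' hf hf'M hfM hη
  rw [hJ', zero_sub, norm_neg] at hle
  have hbound : (((S.finite_hit_closure hM).toFinset.image S.orbitOf).card : ℝ) *
      (((S.finite_hit_closure hM).toFinset.card : ℝ) * (‖S.J χ χ' f‖ / (2 * (C + 1))) * S.μT.real S.DT *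
        S.μT'.real S.DT') = C * (‖S.J χ χ' f‖ / (2 * (C + 1))) := by
    rw [hC]
    ring
  rw [hbound] at hle
  have hlt : C * (‖S.J χ χ' f‖ / (2 * (C + 1))) < ‖S.J χ χ' f‖ := by
    have h2 : 0 < 2 * (C + 1) := by positivity
    have hsplit : C * (‖S.J χ χ' f‖ / (2 * (C + 1))) = (C / (2 * (C + 1))) * ‖S.J χ χ' f‖ := by ring
    rw [hsplit]
    have hfrac : C / (2 * (C + 1)) < 1 := by
      rw [div_lt_one h2]
      linarith
    nlinarith
  exact absurd hle (not_le.2 hlt)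

end Setting

end Summit.Ventures.HodgeRepro.Tier4.Line1.RTF

end
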